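import Literature.AnabelianGeometry.SemiGraphs.TieLabels
import Literature.AnabelianGeometry.SemiGraphs.TieLocalStars
import Literature.AnabelianGeometry.SemiGraphs.FibreDataLabelledLift
import Literature.AnabelianGeometry.SemiGraphs.BranchAlignedDistinctComponents
import Literature.AnabelianGeometry.SemiGraphs.EdgeSectionMono
import Literature.AnabelianGeometry.SemiGraphs.CoveringOfObjectProofs
import Literature.AnabelianGeometry.SemiGraphs.FiniteEtaleCoveringConnectedProofs
import Literature.AnabelianGeometry.SemiGraphs.FiniteEtaleCoveringDictionaryProofs2b

/-!
# The TIE: the canonical labels of a four-clause finite étale covering are bijections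
# ([SemiAnbd] Def. 2.2 (i) p. 23, Rem. 2.2.1 p. 24, Rem. 2.4.2 p. 26)

Mochizuki, *Semi-graphs of anabelioids*, Publ. RIMS **42** (2006) 221–322, §2: Def. 2.2 (i) p. 23 (the
finite étale covering `ℋ → 𝒦` attached to `A ∈ B(𝒦)`: "the vertices (respectively, edges) of `𝔾′` that
lie over a vertex `v` (respectively, an edge `e`) correspond to the connected components of `S_v`
(respectively, `T_e`)"), Rem. 2.2.1 p. 24, Rem. 2.4.2 p. 26 [cite: MochizukiSemiAnbd2006, Def. 2.2(i) p.23].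

PROOF-ONLY companion (abc-iut cell, layer L3; FACT-LIST row F-1478 `remark_2_4_1_covering` and the
«tie» of the dictionary facts (D2)/(D3) / the (L-A) assembly of abc-iut-w5-d041's Route W / the labels of
Route T (J1): brick **(T-δ)**, part 3b = assembly, of `HOME/staging/f/f-161/J1-TIE-ROUTE.md`; seat
abc-iut-f-161).  For a covering `ψ : ℋ → 𝒦` of CONNECTED semi-graphs of anabelioids satisfying the four
clauses of the cell's covering notion of record — LOCAL (`IsFiniteEtaleCoveringOf`), GLOBAL (witness
`αψ`, `e_ψ`), BRANCH-ALIGNED, VERTEX-ALIGNED — the canonical labels `O(w) ⊆ A_u`, `O(e′) ⊆ A_e` of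
`TieLabels` (the components through which the tautological section `g = αψ(η_{𝟙_A}) ≫ e_ψ⁻¹_A` factors,
i.e. holding the global base points):

* `branch_eq_of_sectionE_label_eq` — **injectivity on stars**: two branches at `w` over the same branch
  of `𝕂` whose edges carry the same label coincide (branch alignment (ii) through abc-iut-f-160's (T-β)
  `component_ne_of_branch_ne`, the edge base points being the transports of the vertex one by
  abc-iut-w4-d079's (T-α), and the vertex base point having stabiliser `ι(Π_w)` by vertex alignment);
* `tie_bijective` — **THE TIE**: `w ↦ (ψ w, O w)` and `e′ ↦ (ψ e′, O e′)` are BIJECTIONS onto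
  `Σ_u π₀(A_u)`, `Σ_e π₀(A_e)`, the labels being characterised by the factorisation of `g` and compatible
  with abutment (`componentOver (O e(b′)) = O w`) — i.e. `(O, O_E)` is an isomorphism of semi-graphs
  `ℋ.graph ⥲ 𝔾_A` over `𝕂`.  Assembly: `FibreData.labels_bijective` (abc-iut-f-161 (T-γ)/(T-δ) part 1)
  from injectivity on stars, the star count of `TieLocalStars` transported along `cV w ≅ O w`
  (`TieLabels.nonempty_iso_of_localGlobalSection`), the fibre cardinalities of the local clause, and
  connectedness of `𝔾_A` ((D8) `covering_isConnected_holds`, `A` being connected as `ℋ` is).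

Hypotheses `ℋ.IsConnected` and `𝒦.IsConnected` (the latter only through (D8)); the disconnected case is
componentwise and not treated here.  No `def`, no new `Prop`; nothing here takes a side on
[IUTchIII] Cor. 3.12.
-/

namespace Literature.AnabelianGeometry.SemiGraphs

namespace SemiGraphOfAnabelioids

namespace Hom

open CategoryTheory CategoryTheory.Limits CategoryTheory.PreGaloisCategory
open Literature.AnabelianGeometry.Anabelioids

universe v₁ u₁ u

variable {ℋ 𝒦 : SemiGraphOfAnabelioids.{v₁, u₁, u}} (ψ : Hom ℋ 𝒦) (A : 𝒦.BObj)
  [HasBinaryProducts 𝒦.BObj] (αψ : Over A ⥤ ℋ.BObj) [αψ.IsEquivalence]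
  (eψ : ψ.pullbackFunctor ≅ Over.star A ⋙ αψ)

/-! ### The edge base point lies in the edge label -/

set_option backward.isDefEq.respectTransparency false in
/-- **The transported vertex base point lies in the edge label.**  Along a branch `b′` at `w` over `b`,
with basepoints `F′`, `F_{e′}`, a frame `α′` and one-point fibres `t_V`, `t_E` of the global terminal
object: if `g_{e′}` (re-indexed to the edge of `b`) factors through `ψ_{e′}^*(Q ↪ A_e)`, then the
transported point `F_e(ψ_b)(alignIso⁻¹ a₀)` of the vertex base point `a₀ = F′(g_w)(t_V)` lies in the
fibre-image of `Q` (abc-iut-w4-d079's (T-α) `globalBasePoint_edge_eq_transport`).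
[cite: MochizukiSemiAnbd2006, Rem. 2.4.2 p.26] -/
theorem edgePoint_mem_range_of_sectionE_factors (w : ℋ.graph.Vertex) (F' : ℋ.V w ⥤ FintypeCat.{v₁})
    [FiberFunctor F'] (b' : ℋ.graph.Branch) (h' : ℋ.graph.abuts b' = some w) (b : 𝒦.graph.Branch)
    (p : ψ.base.branchMap b' = b) (Fe' : ℋ.E (ℋ.graph.edgeOf b') ⥤ FintypeCat.{v₁}) [FiberFunctor Fe']
    (α' : (ℋ.pull b' w h').pullback ⋙ Fe' ≅ F')
    [Subsingleton (Fe'.obj ((αψ.obj (Over.mk (𝟙 A))).T (ℋ.graph.edgeOf b')))]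
    (tV : (ℋ.ρ w ⋙ F').obj (αψ.obj (Over.mk (𝟙 A))))
    (tE : (ℋ.ρE (ℋ.graph.edgeOf b') ⋙ Fe').obj (αψ.obj (Over.mk (𝟙 A))))
    (Q : π₀Obj (A.T (𝒦.graph.edgeOf b)))
    (hQ : ∃ k : (αψ.obj (Over.mk (𝟙 A))).T (ℋ.graph.edgeOf b') ⟶
        (ψ.φE (ℋ.graph.edgeOf b') (𝒦.graph.edgeOf b) (ψ.edgeMap_edgeOf_of_branchMap b' b p)).pullback.obj
          (Q.1 : 𝒦.E (𝒦.graph.edgeOf b)),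
      k ≫ (ψ.φE (ℋ.graph.edgeOf b') (𝒦.graph.edgeOf b)
          (ψ.edgeMap_edgeOf_of_branchMap b' b p)).pullback.map Q.1.arrow =
        (αψ.map ((Over.forgetAdjStar A).unit.app (Over.mk (𝟙 A))) ≫ eψ.inv.app A).fT
            (ℋ.graph.edgeOf b') ≫
          (ψ.reindexIso (ℋ.graph.edgeOf b') (ψ.base.edgeMap (ℋ.graph.edgeOf b')) (𝒦.graph.edgeOf b)
            rfl (ψ.edgeMap_edgeOf_of_branchMap b' b p)).hom.app A) :
    ((ψ.φE (ℋ.graph.edgeOf b') (𝒦.graph.edgeOf b) (ψ.edgeMap_edgeOf_of_branchMap b' b p)).pullback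
        ⋙ Fe').map (A.ψ b (ψ.base.vertexMap w) (p ▸ ψ.base.abuts_branchMap b' w h')).hom
      ((ψ.alignIso b' w h' b p F' Fe' α').inv.app (A.S (ψ.base.vertexMap w))
        (show ((ψ.φV w).pullback ⋙ F').obj (A.S (ψ.base.vertexMap w)) from
          (Functor.isoWhiskerLeft (𝒦.ρ (ψ.base.vertexMap w))
              (Iso.refl ((ψ.φV w).pullback ⋙ F'))).hom.app A
            ((ℋ.ρ w ⋙ F').map
              (αψ.map ((Over.forgetAdjStar A).unit.app (Over.mk (𝟙 A))) ≫ eψ.inv.app A) tV))) ∈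
      Set.range (((ψ.φE (ℋ.graph.edgeOf b') (𝒦.graph.edgeOf b)
        (ψ.edgeMap_edgeOf_of_branchMap b' b p)).pullback ⋙ Fe').map Q.1.arrow) := by
  let R := (ψ.φE (ℋ.graph.edgeOf b') (𝒦.graph.edgeOf b) (ψ.edgeMap_edgeOf_of_branchMap b' b p)).pullback
  haveI : PreGaloisCategory.IsConnected ((ℋ.ρE (ℋ.graph.edgeOf b')).obj (αψ.obj (Over.mk (𝟙 A)))) :=
    isConnected_T_terminal A αψ (ℋ.graph.edgeOf b')
  haveI : Mono (R.map Q.1.arrow) := inferInstance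
  have hQmem := (factor_iff_map_mem_range Fe' (R.map Q.1.arrow) _ tE).mp hQ
  rw [← ψ.globalBasePoint_edge_eq_transport A αψ eψ w F' b' h' b p Fe' α' tV tE]
  change (Fe'.map ((ψ.reindexIso (ℋ.graph.edgeOf b') (ψ.base.edgeMap (ℋ.graph.edgeOf b'))
      (𝒦.graph.edgeOf b) rfl (ψ.edgeMap_edgeOf_of_branchMap b' b p)).hom.app A) ≫ 𝟙 _)
    (Fe'.map ((αψ.map ((Over.forgetAdjStar A).unit.app (Over.mk (𝟙 A))) ≫ eψ.inv.app A).fT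
      (ℋ.graph.edgeOf b')) tE) ∈ Set.range ((R ⋙ Fe').map Q.1.arrow)
  rw [Category.comp_id]
  rw [Fe'.map_comp, FintypeCat.comp_apply] at hQmem
  exact hQmem

/-! ### Injectivity on stars (branch alignment (ii), via (T-β)) -/

omit [HasBinaryProducts 𝒦.BObj] in
/-- Bookkeeping: equal points of `Σ e, π₀(A_e)` have equal re-indexed components.
[cite: MochizukiSemiAnbd2006, Def. 2.2(i) p.23] -/
theorem eqRec_eq_of_sigma_eq {e₁ e₂ e : 𝒦.graph.Edge} (h₁ : e₁ = e) (h₂ : e₂ = e)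
    (Q₁ : π₀Obj (A.T e₁)) (Q₂ : π₀Obj (A.T e₂))
    (h : (⟨e₁, Q₁⟩ : Σ e, π₀Obj (A.T e)) = ⟨e₂, Q₂⟩) :
    (h₁ ▸ Q₁ : π₀Obj (A.T e)) = h₂ ▸ Q₂ := by
  subst h₁; subst h₂
  exact eq_of_heq (Sigma.mk.inj_iff.mp h).2

set_option backward.isDefEq.respectTransparency false in
/-- **Injectivity on stars.**  Let `ψ` carry the local description of the covering of `A` and be
branch- and vertex-aligned.  If two branches `b′₁`, `b′₂` of `ℋ` at `w` lie over the same branch of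
`𝕂` and their edges carry the same canonical label (the components through which `g_{e′ᵢ}` factor give
the same point of `Σ_e π₀(A_e)`), then `b′₁ = b′₂`: otherwise branch alignment (ii) separates the two
edge base points into different components (abc-iut-f-160 `component_ne_of_branch_ne`), while both are
the transports of the vertex base point `a₀` ((T-α)), whose `Π_u`-stabiliser is `ι(Π_w)` by vertex
alignment (abc-iut-w4-d079 `stabilizer_eq_of_ranges`). [cite: MochizukiSemiAnbd2006, Def. 2.2(i) p.23] -/
theorem branch_eq_of_sectionE_label_eq (hloc : ψ.IsFiniteEtaleCoveringOf A) (hal : ψ.IsBranchAligned)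
    (hva : ψ.IsVertexAligned) (w : ℋ.graph.Vertex) (b'₁ b'₂ : ℋ.graph.Branch)
    (h₁ : ℋ.graph.abuts b'₁ = some w) (h₂ : ℋ.graph.abuts b'₂ = some w)
    (hb : ψ.base.branchMap b'₁ = ψ.base.branchMap b'₂)
    (Q₁ : π₀Obj (A.T (ψ.base.edgeMap (ℋ.graph.edgeOf b'₁))))
    (Q₂ : π₀Obj (A.T (ψ.base.edgeMap (ℋ.graph.edgeOf b'₂))))
    (hQ₁ : ∃ k : (αψ.obj (Over.mk (𝟙 A))).T (ℋ.graph.edgeOf b'₁) ⟶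
        (ψ.φE _ (ψ.base.edgeMap (ℋ.graph.edgeOf b'₁)) rfl).pullback.obj (Q₁.1 : 𝒦.E _),
      k ≫ (ψ.φE _ (ψ.base.edgeMap (ℋ.graph.edgeOf b'₁)) rfl).pullback.map Q₁.1.arrow =
        (αψ.map ((Over.forgetAdjStar A).unit.app (Over.mk (𝟙 A))) ≫ eψ.inv.app A).fT (ℋ.graph.edgeOf b'₁))
    (hQ₂ : ∃ k : (αψ.obj (Over.mk (𝟙 A))).T (ℋ.graph.edgeOf b'₂) ⟶
        (ψ.φE _ (ψ.base.edgeMap (ℋ.graph.edgeOf b'₂)) rfl).pullback.obj (Q₂.1 : 𝒦.E _),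
      k ≫ (ψ.φE _ (ψ.base.edgeMap (ℋ.graph.edgeOf b'₂)) rfl).pullback.map Q₂.1.arrow =
        (αψ.map ((Over.forgetAdjStar A).unit.app (Over.mk (𝟙 A))) ≫ eψ.inv.app A).fT (ℋ.graph.edgeOf b'₂))
    (hlab : (⟨ψ.base.edgeMap (ℋ.graph.edgeOf b'₁), Q₁⟩ : Σ e, π₀Obj (A.T e)) =
      ⟨ψ.base.edgeMap (ℋ.graph.edgeOf b'₂), Q₂⟩) :
    b'₁ = b'₂ := by
  by_contra hne
  -- present both branches over `b := ψ b′₁`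
  set b := ψ.base.branchMap b'₁ with hbdef
  have p₁ : ψ.base.branchMap b'₁ = b := rfl
  have p₂ : ψ.base.branchMap b'₂ = b := hb.symm
  -- the two labels, re-indexed to the edge of `b`, coincide
  let P₁ : π₀Obj (A.T (𝒦.graph.edgeOf b)) := (ψ.edgeMap_edgeOf_of_branchMap b'₁ b p₁) ▸ Q₁
  let P₂ : π₀Obj (A.T (𝒦.graph.edgeOf b)) := (ψ.edgeMap_edgeOf_of_branchMap b'₂ b p₂) ▸ Q₂
  have hP : P₁ = P₂ := eqRec_eq_of_sigma_eq A _ _ Q₁ Q₂ hlab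
  -- basepoints: `F′` of `ℋ_w`, `F_{e′ᵢ}` of `ℋ_{e′ᵢ}`, frames `α′ᵢ`, an identification `θ`
  let F' := GaloisCategory.getFiberFunctor (ℋ.V w)
  let Fe'₁ := GaloisCategory.getFiberFunctor (ℋ.E (ℋ.graph.edgeOf b'₁))
  let Fe'₂ := GaloisCategory.getFiberFunctor (ℋ.E (ℋ.graph.edgeOf b'₂))
  haveI : FiberFunctor ((ℋ.pull b'₁ w h₁).pullback ⋙ Fe'₁) := fiberFunctor_comp_of_exact _ Fe'₁
  haveI : FiberFunctor ((ℋ.pull b'₂ w h₂).pullback ⋙ Fe'₂) := fiberFunctor_comp_of_exact _ Fe'₂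
  obtain ⟨α'₁⟩ := nonempty_iso_of_fiberFunctor ((ℋ.pull b'₁ w h₁).pullback ⋙ Fe'₁) F'
  obtain ⟨α'₂⟩ := nonempty_iso_of_fiberFunctor ((ℋ.pull b'₂ w h₂).pullback ⋙ Fe'₂) F'
  let F : 𝒦.V (ψ.base.vertexMap w) ⥤ FintypeCat.{v₁} := (ψ.φV w).pullback ⋙ F'
  haveI : FiberFunctor F := fiberFunctor_comp_of_exact _ F'
  let R₁ := (ψ.φE (ℋ.graph.edgeOf b'₁) (𝒦.graph.edgeOf b) (ψ.edgeMap_edgeOf_of_branchMap b'₁ b p₁)).pullback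
  let R₂ := (ψ.φE (ℋ.graph.edgeOf b'₂) (𝒦.graph.edgeOf b) (ψ.edgeMap_edgeOf_of_branchMap b'₂ b p₂)).pullback
  haveI : FiberFunctor (R₁ ⋙ Fe'₁) := fiberFunctor_comp_of_exact _ Fe'₁
  haveI : FiberFunctor (R₂ ⋙ Fe'₂) := fiberFunctor_comp_of_exact _ Fe'₂
  obtain ⟨θ⟩ := nonempty_iso_of_fiberFunctor (R₂ ⋙ Fe'₂) (R₁ ⋙ Fe'₁)
  -- one-point fibres of the global terminal object at `w`, `e′₁`, `e′₂`
  obtain ⟨eTV⟩ := nonempty_equiv_fiber_terminal_punit F'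
  obtain ⟨eTE₁⟩ := nonempty_equiv_fiber_terminal_punit Fe'₁
  obtain ⟨eTE₂⟩ := nonempty_equiv_fiber_terminal_punit Fe'₂
  obtain ⟨-, hρ, hρE⟩ := ℋ.hasLimitsOfShape_bObj (J := Discrete PEmpty.{1})
  haveI := hρ w
  haveI := hρE (ℋ.graph.edgeOf b'₁)
  haveI := hρE (ℋ.graph.edgeOf b'₂)
  have hTA : IsTerminal (αψ.obj (Over.mk (𝟙 A))) := Over.mkIdTerminal.isTerminalObj αψ _
  let iV : (ℋ.ρ w).obj (αψ.obj (Over.mk (𝟙 A))) ≅ ⊤_ (ℋ.V w) :=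
    (hTA.isTerminalObj (ℋ.ρ w) _).uniqueUpToIso terminalIsTerminal
  let iE₁ : (ℋ.ρE (ℋ.graph.edgeOf b'₁)).obj (αψ.obj (Over.mk (𝟙 A))) ≅ ⊤_ (ℋ.E (ℋ.graph.edgeOf b'₁)) :=
    (hTA.isTerminalObj (ℋ.ρE (ℋ.graph.edgeOf b'₁)) _).uniqueUpToIso terminalIsTerminal
  let iE₂ : (ℋ.ρE (ℋ.graph.edgeOf b'₂)).obj (αψ.obj (Over.mk (𝟙 A))) ≅ ⊤_ (ℋ.E (ℋ.graph.edgeOf b'₂)) :=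
    (hTA.isTerminalObj (ℋ.ρE (ℋ.graph.edgeOf b'₂)) _).uniqueUpToIso terminalIsTerminal
  haveI hsV : Subsingleton (F'.obj ((αψ.obj (Over.mk (𝟙 A))).S w)) :=
    ((FintypeCat.equivEquivIso.symm (F'.mapIso iV)).trans eTV).subsingleton
  haveI : Subsingleton ((ℋ.ρ w ⋙ F').obj (αψ.obj (Over.mk (𝟙 A)))) := hsV
  haveI hsE₁ : Subsingleton (Fe'₁.obj ((αψ.obj (Over.mk (𝟙 A))).T (ℋ.graph.edgeOf b'₁))) :=
    ((FintypeCat.equivEquivIso.symm (Fe'₁.mapIso iE₁)).trans eTE₁).subsingleton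
  haveI hsE₂ : Subsingleton (Fe'₂.obj ((αψ.obj (Over.mk (𝟙 A))).T (ℋ.graph.edgeOf b'₂))) :=
    ((FintypeCat.equivEquivIso.symm (Fe'₂.mapIso iE₂)).trans eTE₂).subsingleton
  let tV : (ℋ.ρ w ⋙ F').obj (αψ.obj (Over.mk (𝟙 A))) :=
    (FintypeCat.equivEquivIso.symm (F'.mapIso iV)).symm (eTV.symm PUnit.unit)
  let tE₁ : (ℋ.ρE (ℋ.graph.edgeOf b'₁) ⋙ Fe'₁).obj (αψ.obj (Over.mk (𝟙 A))) :=
    (FintypeCat.equivEquivIso.symm (Fe'₁.mapIso iE₁)).symm (eTE₁.symm PUnit.unit)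
  let tE₂ : (ℋ.ρE (ℋ.graph.edgeOf b'₂) ⋙ Fe'₂).obj (αψ.obj (Over.mk (𝟙 A))) :=
    (FintypeCat.equivEquivIso.symm (Fe'₂.mapIso iE₂)).symm (eTE₂.symm PUnit.unit)
  -- the vertex base point has stabiliser `ι(Π_w)`: (D1) globally and locally, vertex alignment
  obtain ⟨-, cV, -, -, -, hαV, -, -⟩ := hloc
  obtain ⟨αw, hαw, ⟨ew⟩⟩ := hαV w
  haveI := hαw
  haveI := (cV w).2
  have hTP : IsTerminal (αw.obj (Over.mk (𝟙 ((cV w).1 : 𝒦.V (ψ.base.vertexMap w))))) :=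
    Over.mkIdTerminal.isTerminalObj αw _
  let iP : αw.obj (Over.mk (𝟙 ((cV w).1 : 𝒦.V (ψ.base.vertexMap w)))) ≅ ⊤_ (ℋ.V w) :=
    hTP.uniqueUpToIso terminalIsTerminal
  haveI : Subsingleton (F'.obj (αw.obj (Over.mk (𝟙 ((cV w).1 : 𝒦.V (ψ.base.vertexMap w)))))) :=
    ((FintypeCat.equivEquivIso.symm (F'.mapIso iP)).trans eTV).subsingleton
  let t' : F'.obj (αw.obj (Over.mk (𝟙 ((cV w).1 : 𝒦.V (ψ.base.vertexMap w))))) :=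
    (FintypeCat.equivEquivIso.symm (F'.mapIso iP)).symm (eTV.symm PUnit.unit)
  haveI : PreservesLimitsOfShape WalkingCospan (ℋ.ρ w) := preservesPullbacks_ρ ℋ w
  haveI : PreservesLimitsOfShape WalkingCospan (ℋ.ρ w ⋙ F') := inferInstance
  haveI : (ℋ.ρ w ⋙ F').PreservesMonomorphisms := inferInstance
  have ha := range_pi1Map_eq_stabilizer' αψ eψ (ℋ.ρ w ⋙ F')
    (Functor.isoWhiskerLeft (𝒦.ρ (ψ.base.vertexMap w)) (Iso.refl F)) tV
  have hp := range_pi1Map_eq_stabilizer' αw ew F' (Iso.refl F) t'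
  have hst := hva.stabilizer_eq_of_ranges w F' F (Iso.refl F) _ ha (cV w).1.arrow _ hp
  rw [range_autMulEquivOfIso_refl_comp] at hp
  have hx : (pi1Map (ψ.φV w).pullback F').range = MulAction.stabilizer (Aut ((ψ.φV w).pullback ⋙ F'))
      (show ((ψ.φV w).pullback ⋙ F').obj (A.S (ψ.base.vertexMap w)) from
        (Functor.isoWhiskerLeft (𝒦.ρ (ψ.base.vertexMap w)) (Iso.refl ((ψ.φV w).pullback ⋙ F'))).hom.app A
          ((ℋ.ρ w ⋙ F').map (αψ.map ((Over.forgetAdjStar A).unit.app (Over.mk (𝟙 A))) ≫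
            eψ.inv.app A) tV)) :=
    hp.trans hst.symm
  -- the two edge base points lie in `P₁`, `P₂`
  have hP₁ := edgePoint_mem_range_of_sectionE_factors ψ A αψ eψ w F' b'₁ h₁ b p₁ Fe'₁ α'₁ tV tE₁ P₁
    (sectionE_factors_reindex ψ A αψ eψ _ _ (ψ.edgeMap_edgeOf_of_branchMap b'₁ b p₁) Q₁ hQ₁)
  have hP₂ := edgePoint_mem_range_of_sectionE_factors ψ A αψ eψ w F' b'₂ h₂ b p₂ Fe'₂ α'₂ tV tE₂ P₂
    (sectionE_factors_reindex ψ A αψ eψ _ _ (ψ.edgeMap_edgeOf_of_branchMap b'₂ b p₂) Q₂ hQ₂)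
  exact IsBranchAligned.component_ne_of_branch_ne hal w F' b b'₁ b'₂ h₁ h₂ p₁ p₂ hne Fe'₁ α'₁ Fe'₂ α'₂
    θ _ hx P₁ P₂ hP₁ hP₂ hP

/-! ### Assembly: the TIE -/

omit [HasBinaryProducts 𝒦.BObj] in
/-- Bookkeeping: equality of shrunk labels in `Σ e, 𝔾_A.FE e` is equality of labels in `Σ e, π₀(A_e)`.
[cite: MochizukiSemiAnbd2006, Def. 2.2(i) p.23] -/
theorem sigma_eq_of_sigma_shrink_eq {e₁ e₂ : 𝒦.graph.Edge} (Q₁ : π₀Obj (A.T e₁)) (Q₂ : π₀Obj (A.T e₂))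
    (h : (⟨e₁, equivShrink _ Q₁⟩ : Σ e, A.fibreData.FE e) = ⟨e₂, equivShrink _ Q₂⟩) :
    (⟨e₁, Q₁⟩ : Σ e, π₀Obj (A.T e)) = ⟨e₂, Q₂⟩ := by
  obtain ⟨h1, h2⟩ := Sigma.mk.inj_iff.mp h
  subst h1
  rw [(equivShrink _).injective (eq_of_heq h2)]

set_option backward.isDefEq.respectTransparency false in
/-- **THE TIE** ([SemiAnbd] Def. 2.2 (i): the vertices and edges of the covering ARE the connected
components of the `A_u`, `A_e`).  Let `ψ : ℋ → 𝒦` be a morphism of CONNECTED semi-graphs of anabelioids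
which is LOCALLY the covering attached to `A ∈ B(𝒦)` (`IsFiniteEtaleCoveringOf`), GLOBALLY so through the
witness `αψ : B(𝒦)_{/A} ⥲ B(ℋ)`, `e_ψ : ψ^* ≅ (A × −) ⋙ αψ`, BRANCH-ALIGNED and VERTEX-ALIGNED.  Then there
are labels `O(w) ∈ π₀(A_{ψ w})`, `O(e′) ∈ π₀(A_{ψ e′})` such that
(1) `w ↦ (ψ w, O w)` is a bijection onto `Σ_u π₀(A_u)`; (2) `e′ ↦ (ψ e′, O e′)` is a bijection onto
`Σ_e π₀(A_e)`; (3)/(4) `O(w)` (resp. `O(e′)`) is THE component through which the constituent at `w` (resp.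
`e′`) of the tautological section `g = αψ(η_{𝟙_A}) ≫ e_ψ⁻¹_A : αψ 𝟙_A ⟶ ψ^*A` factors — the component
holding the global base point; (5) for a branch `b′` at `w`, the component of `A_{ψ w}` under `O(e(b′))`
along `ψ b′` is `O(w)` — the labels form an ISOMORPHISM of semi-graphs `ℋ.graph ⥲ 𝔾_A` over `𝕂`.
This is the «tie» between the local labels and the global witness that the pure-group-form alignment
clauses do not record (dictionary facts (D2)/(D3); the (L-A) assembly of F-1478).
[cite: MochizukiSemiAnbd2006, Def. 2.2(i) p.23] -/
theorem tie_bijective (hloc : ψ.IsFiniteEtaleCoveringOf A) (hal : ψ.IsBranchAligned)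
    (hva : ψ.IsVertexAligned) (hℋ : ℋ.IsConnected) (h𝒦 : 𝒦.IsConnected) :
    ∃ (O : ∀ w : ℋ.graph.Vertex, π₀Obj (A.S (ψ.base.vertexMap w)))
      (OE : ∀ e' : ℋ.graph.Edge, π₀Obj (A.T (ψ.base.edgeMap e'))),
      Function.Bijective (fun w : ℋ.graph.Vertex =>
        (⟨ψ.base.vertexMap w, O w⟩ : Σ u, π₀Obj (A.S u))) ∧
      Function.Bijective (fun e' : ℋ.graph.Edge =>
        (⟨ψ.base.edgeMap e', OE e'⟩ : Σ e, π₀Obj (A.T e))) ∧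
      (∀ (w : ℋ.graph.Vertex) (P : π₀Obj (A.S (ψ.base.vertexMap w))),
        P = O w ↔ ∃ k : (αψ.obj (Over.mk (𝟙 A))).S w ⟶
            (ψ.φV w).pullback.obj (P.1 : 𝒦.V (ψ.base.vertexMap w)),
          k ≫ (ψ.φV w).pullback.map P.1.arrow =
            (αψ.map ((Over.forgetAdjStar A).unit.app (Over.mk (𝟙 A))) ≫ eψ.inv.app A).fS w) ∧
      (∀ (e' : ℋ.graph.Edge) (Q : π₀Obj (A.T (ψ.base.edgeMap e'))),
        Q = OE e' ↔ ∃ k : (αψ.obj (Over.mk (𝟙 A))).T e' ⟶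
            (ψ.φE e' (ψ.base.edgeMap e') rfl).pullback.obj (Q.1 : 𝒦.E (ψ.base.edgeMap e')),
          k ≫ (ψ.φE e' (ψ.base.edgeMap e') rfl).pullback.map Q.1.arrow =
            (αψ.map ((Over.forgetAdjStar A).unit.app (Over.mk (𝟙 A))) ≫ eψ.inv.app A).fT e') ∧
      (∀ (b' : ℋ.graph.Branch) (w : ℋ.graph.Vertex) (h' : ℋ.graph.abuts b' = some w),
        A.componentOver (ψ.base.branchMap b') (ψ.base.vertexMap w) (ψ.base.abuts_branchMap b' w h')
            ((ψ.base.edgeOf_branchMap b').symm ▸ OE (ℋ.graph.edgeOf b')) = O w) := by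
  classical
  -- the labels
  have hU := fun w => existsUnique_component_section_factors ψ A αψ eψ w
  have hUE := fun e' => existsUnique_component_sectionE_factors ψ A αψ eψ e'
  choose O hO using fun w => (hU w).exists
  choose OE hOE using fun e' => (hUE e').exists
  -- (5) abutment compatibility
  have h5 : ∀ (b' : ℋ.graph.Branch) (w : ℋ.graph.Vertex) (h' : ℋ.graph.abuts b' = some w),
      A.componentOver (ψ.base.branchMap b') (ψ.base.vertexMap w) (ψ.base.abuts_branchMap b' w h')
        ((ψ.base.edgeOf_branchMap b').symm ▸ OE (ℋ.graph.edgeOf b')) = O w := fun b' w h' =>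
    componentOver_eq_of_section_factors ψ A αψ eψ w b' h' (ψ.base.branchMap b') rfl (O w) (hO w) _
      (sectionE_factors_reindex ψ A αψ eψ _ _ (ψ.edgeMap_edgeOf_of_branchMap b' _ rfl) (OE _) (hOE _))
  -- the local description
  obtain ⟨hprop, cV, cE, hbijV, hbijE, hαV, -, hbr⟩ := _root_.id hloc
  -- the fibre data `𝔾_A` and the shrunk labels
  let D := A.fibreData
  let ℓV : ∀ w : ℋ.graph.Vertex, D.FV (ψ.base.vertexMap w) := fun w => equivShrink _ (O w)
  let ℓE : ∀ e' : ℋ.graph.Edge, D.FE (ψ.base.edgeMap e') := fun e' => equivShrink _ (OE e')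
  haveI : ∀ u, Finite (D.FV u) := fun u => Finite.of_equiv _ (equivShrink (π₀Obj (A.S u)))
  haveI : ∀ e, Finite (D.FE e) := fun e => Finite.of_equiv _ (equivShrink (π₀Obj (A.T e)))
  have hcast : ∀ {e₁ e₂ : 𝒦.graph.Edge} (h : e₁ = e₂) (Q : π₀Obj (A.T e₁)),
      cast (congrArg D.FE h) (equivShrink _ Q) = equivShrink _ (h ▸ Q : π₀Obj (A.T e₂)) := by
    intro e₁ e₂ h Q
    subst h
    rfl
  -- compatibility with abutment
  have hcompat : ∀ (b' : ℋ.graph.Branch) (w : ℋ.graph.Vertex) (h' : ℋ.graph.abuts b' = some w),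
      D.σ (ψ.base.branchMap b') (ψ.base.vertexMap w) (ψ.base.abuts_branchMap b' w h')
        (cast (congrArg D.FE (ψ.base.edgeOf_branchMap b').symm) (ℓE (ℋ.graph.edgeOf b'))) = ℓV w := by
    intro b' w h'
    change equivShrink _ (A.componentOver _ _ _
      ((equivShrink _).symm (cast _ (equivShrink _ (OE (ℋ.graph.edgeOf b')))))) = equivShrink _ (O w)
    rw [hcast (ψ.base.edgeOf_branchMap b').symm, Equiv.symm_apply_apply, h5 b' w h']
  -- injectivity on stars
  have hinj : ∀ (w : ℋ.graph.Vertex) (b'₁ b'₂ : ℋ.graph.Branch), ℋ.graph.abuts b'₁ = some w →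
      ℋ.graph.abuts b'₂ = some w → ψ.base.branchMap b'₁ = ψ.base.branchMap b'₂ →
      (⟨ψ.base.edgeMap (ℋ.graph.edgeOf b'₁), ℓE (ℋ.graph.edgeOf b'₁)⟩ : Σ e, D.FE e) =
        ⟨ψ.base.edgeMap (ℋ.graph.edgeOf b'₂), ℓE (ℋ.graph.edgeOf b'₂)⟩ → b'₁ = b'₂ :=
    fun w b'₁ b'₂ h₁ h₂ hb hs =>
      branch_eq_of_sectionE_label_eq ψ A αψ eψ hloc hal hva w b'₁ b'₂ h₁ h₂ hb (OE _) (OE _) (hOE _)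
        (hOE _) (sigma_eq_of_sigma_shrink_eq A _ _ hs)
  -- the star count: through `cV w ≅ O w` and the local clause
  have hcard : ∀ (w : ℋ.graph.Vertex) (b : 𝒦.graph.Branch)
      (hb : 𝒦.graph.abuts b = some (ψ.base.vertexMap w)),
      Nat.card {c : D.FE (𝒦.graph.edgeOf b) // D.σ b (ψ.base.vertexMap w) hb c = ℓV w} ≤
        Nat.card {b' : ℋ.graph.Branch // ℋ.graph.abuts b' = some w ∧ ψ.base.branchMap b' = b} := by
    intro w b hb
    obtain ⟨αw, hαw, ⟨ew⟩⟩ := hαV w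
    haveI := hαw
    haveI := (cV w).2
    obtain ⟨i, -⟩ := nonempty_iso_of_localGlobalSection ψ A αψ eψ hva w
      ((cV w).1 : 𝒦.V (ψ.base.vertexMap w)) (cV w).1.arrow αw ew (O w) (hO w)
    have e1 : {c : D.FE (𝒦.graph.edgeOf b) // D.σ b (ψ.base.vertexMap w) hb c = ℓV w} ≃
        {Q : π₀Obj (A.T (𝒦.graph.edgeOf b)) // A.componentOver b (ψ.base.vertexMap w) hb Q = O w} :=
      Equiv.subtypeEquiv (equivShrink _).symm (fun c =>
        (equivShrink (π₀Obj (A.S (ψ.base.vertexMap w)))).apply_eq_iff_eq)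
    calc Nat.card {c : D.FE (𝒦.graph.edgeOf b) // D.σ b (ψ.base.vertexMap w) hb c = ℓV w}
        = Nat.card {Q : π₀Obj (A.T (𝒦.graph.edgeOf b)) //
            A.componentOver b (ψ.base.vertexMap w) hb Q = O w} := Nat.card_congr e1
      _ = Nat.card {Q : π₀Obj (A.T (𝒦.graph.edgeOf b)) //
            Q.1 ≤ A.branchImage b (ψ.base.vertexMap w) hb (O w).1} :=
          Nat.card_congr (Equiv.subtypeEquivRight fun Q =>
            A.componentOver_eq_iff_le_branchImage b _ hb Q (O w))
      _ = Nat.card {Q : π₀Obj (A.T (𝒦.graph.edgeOf b)) //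
            Q.1 ≤ A.branchImage b (ψ.base.vertexMap w) hb (cV w).1} :=
          (A.natCard_le_branchImage_eq_of_iso b _ hb (cV w) (O w) i).symm
      _ = Nat.card {Q : π₀Obj (A.T (𝒦.graph.edgeOf b)) //
            A.componentOver b (ψ.base.vertexMap w) hb Q = cV w} :=
          Nat.card_congr (Equiv.subtypeEquivRight fun Q =>
            (A.componentOver_eq_iff_le_branchImage b _ hb Q (cV w)).symm)
      _ ≤ _ := natCard_componentOver_eq_le_natCard_branches ψ A cV cE hprop hbijV.1 hbijE hbr w b hb
  -- `𝔾_A` is connected: `A` is connected since `ℋ` is ((D8), abc-iut-L3-d3/L3-t5)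
  haveI : PreGaloisCategory.IsConnected A :=
    isConnected_of_isGlobalCovering hℋ ψ A ⟨‹_›, αψ, ‹_›, ⟨eψ⟩⟩
  have hconn : D.total.IsConnected :=
    (covering_isConnected_holds 𝒦 A.coveringGraph A.coveringHomCan A h𝒦
      A.coveringHomCan_isFiniteEtaleCoveringOf ‹_›).isConnected
  -- the fibres of `ψ` have the cardinalities of `𝔾_A` (local labels)
  have eV : ∀ u, Nonempty (ψ.base.VertexFiber u ≃ D.FV u) := fun u =>
    D.nonempty_vertexFiber_equiv_of_bijective ψ.base (fun w => equivShrink _ (cV w))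
      ((Equiv.sigmaCongrRight fun v => equivShrink (π₀Obj (A.S v))).bijective.comp hbijV) u
  have eE : ∀ e, Nonempty (ψ.base.EdgeFiber e ≃ D.FE e) := fun e =>
    D.nonempty_edgeFiber_equiv_of_bijective ψ.base (fun e' => equivShrink _ (cE e'))
      ((Equiv.sigmaCongrRight fun e => equivShrink (π₀Obj (A.T e))).bijective.comp hbijE) e
  -- (T-γ) through the labelled lift
  obtain ⟨hbV, hbE⟩ := D.labels_bijective ψ.base ℓV ℓE hprop hcompat hinj hcard hconn eV eE
  refine ⟨O, OE, ?_, ?_, fun w P => ⟨fun h => h ▸ hO w, fun hP => (hU w).unique hP (hO w)⟩,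
    fun e' Q => ⟨fun h => h ▸ hOE e', fun hQ => (hUE e').unique hQ (hOE e')⟩, h5⟩
  · have hf : (fun w : ℋ.graph.Vertex => (⟨ψ.base.vertexMap w, O w⟩ : Σ u, π₀Obj (A.S u))) =
        (Equiv.sigmaCongrRight fun u => (equivShrink (π₀Obj (A.S u))).symm) ∘
          (fun w : ℋ.graph.Vertex => (⟨ψ.base.vertexMap w, ℓV w⟩ : Σ u, D.FV u)) := by
      funext w
      change _ = (⟨ψ.base.vertexMap w, (equivShrink _).symm (equivShrink _ (O w))⟩ :
        Σ u, π₀Obj (A.S u))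
      rw [Equiv.symm_apply_apply]
    rw [hf]
    exact (Equiv.bijective _).comp hbV
  · have hf : (fun e' : ℋ.graph.Edge => (⟨ψ.base.edgeMap e', OE e'⟩ : Σ e, π₀Obj (A.T e))) =
        (Equiv.sigmaCongrRight fun e => (equivShrink (π₀Obj (A.T e))).symm) ∘
          (fun e' : ℋ.graph.Edge => (⟨ψ.base.edgeMap e', ℓE e'⟩ : Σ e, D.FE e)) := by
      funext e'
      change _ = (⟨ψ.base.edgeMap e', (equivShrink _).symm (equivShrink _ (OE e'))⟩ :
        Σ e, π₀Obj (A.T e))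
      rw [Equiv.symm_apply_apply]
    rw [hf]
    exact (Equiv.bijective _).comp hbE

end Hom

end SemiGraphOfAnabelioids

end Literature.AnabelianGeometry.SemiGraphs
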